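import Summits.BirchSwinnertonDyer.BirchSwinnertonDyer.Theorems.KimAtThreeD7uRefinedNorm
import Summits.BirchSwinnertonDyer.BirchSwinnertonDyer.Theorems.KimAtThreeD7uRefinedAmbientRes
import Summits.BirchSwinnertonDyer.Rank1Residual.GaloisImage.KolyvaginDerivativeClasses
import Summits.BirchSwinnertonDyer.Rank1Residual.GaloisImage.KolyvaginDerivativeNormCompatible
import HarnessLib

/-!
# D7-u, file C4: the REFINED THEOREM A2 (route W2 = `KimAtThreeKolyvagin`, crux 19560 (C3) /
# TamDiv∞; seat `bsd-addord-w2-tamdiv`)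

n1011-p11's THEOREM A2 (F3b `Derivative.conjMap_deriv_eq`, [Rubin00] Lemma 4.4.2): `D_r (red_* c_{i,r})`
is fixed by `Gal(K̄/F_i)`.  This file re-runs the same abstract induction (F1
`apply_noncommProd_deriv_apply_eq_of_eulerFamily`) in the REFINED module `S ⧸ N` of files A–C2″
(refined data `(z, η)` for a place datum `D ≥ I` modulo null data), into which the `T`-UNRAMIFIED
Euler-system classes are mapped by the equivariant refined reduction `ρ̂` (files B, C1); the
relations hold in `H¹(U_r, T)` (F3a, file C3) and are transported by `ρ̂`; `U_r` acts trivially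
(file A).  Output (`exists_refined_deriv_fixed`): refined data `(z, η)` with `[z] = D_r (red_* c_{i,r})`,
(C2), (L), and `g · (z, η) − (z, η)` NULL for every `g ∈ Gal(K̄/F_i)` — the input of file A's
extraction lemma ([MR04] Remark A.5 / [Ru00] Thm. 4.5.1 at the RAMIFIED primes; seat memo
W2-TAMDIV-D7U-DESCENT-g0.md).  Extra binders w.r.t. F3b: `B, D, I, hIU, hID, hB` and `hur` (the
classes `res c_{i,s}`, `s ⊆ r`, are coboundaries on every conjugate of `I` at the `T`-level; for
Kato: Astérisque 295 Thm. 12.5 (1) + Lemma 8.5).  No definition, no named fact, no `sorry`.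
References: K. Rubin, *Euler Systems* (2000), Lemma 4.4.2, Thm. 4.5.1, §4.6; B. Mazur, K. Rubin,
Mem. AMS 799 (2004), App. A Prop. A.2, Remark A.5; K. Kato, Astérisque 295 (2004), Lemma 8.5, §13.
-/

set_option autoImplicit false
-- the Theorems namespace of a single-conjunct summit repeats the summit name by design (D-0017)
set_option linter.dupNamespace false

noncomputable section

open CategoryTheory Function Finset Polynomial Field IsDedekindDomain
open scoped NumberField Classical
open Literature.NumberTheory.GaloisRepresentations
open Literature.NumberTheory.EllipticCurves (subgroupConj subgroupConj_apply_coe)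
open Summit.BirchSwinnertonDyer.Rank1Residual.GaloisImage
open Summit.BirchSwinnertonDyer.Rank1Residual.GaloisImage.Derivative

universe u v w

namespace Summit.BirchSwinnertonDyer.BirchSwinnertonDyer.Theorems.KimAtThreeD7uRefined

variable {K : Type u} [Field K] [NumberField K] {ι : Type w} [Preorder ι] [OrderBot ι]
variable {A : Type v} [CommRing A] [TopologicalSpace A]
variable {M : Type u} [AddCommGroup M] [Module A M] [TopologicalSpace M] [IsTopologicalAddGroup M]
  [ContinuousSMul A M] [Module.Free A M] [Module.Finite A M]
variable {L : EulerSystemLevels K ι} {T : GaloisRep K A M} {p : ℕ} [Fact p.Prime] [Algebra ℤ_[p] A]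
variable {c : ∀ (i : ι) (r : L.Ideals), H1 T (L.level i r.1)}
variable {M' : Type u} [AddCommGroup M'] [Module A M'] [TopologicalSpace M'] [IsTopologicalAddGroup M']
  [ContinuousSMul A M'] {T' : GaloisRep K A M'}

/-- Local notation: `𝔠⟦Y, U, g⟧ φ` = the conjugate cocycle `x ↦ g • φ(g⁻¹ x g)` on `U`. -/
local notation3 (prettyPrint := false) "𝔠⟦" Y ", " U ", " g "⟧" => contOneCocycles.pullback (subgroupConj U g) (conjRepHom Y U g)

/-- Local notation: `𝔠₁⟦U, g⟧ f` = the conjugate function `x ↦ g • f(g⁻¹ x g)` for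
`f ∈ C(U, T'|U)` (literally the first component of file A's conjugate cocycle). -/
local notation3 (prettyPrint := false) "𝔠₁⟦" U ", " g "⟧" =>
  fun (f : C(U, subgroupRep (ContinuousRep.toTopRep T') U)) =>
  ((conjRepHom (ContinuousRep.toTopRep T') U g).hom :
      C(TopRep.res (subgroupConj U g : U →* U) (subgroupRep (ContinuousRep.toTopRep T') U),
        subgroupRep (ContinuousRep.toTopRep T') U)).comp (f.comp (subgroupConj U g : C(U, U)))

set_option maxHeartbeats 3200000 in
open scoped commutatorElement in
/-- **REFINED THEOREM A2.**  In F3b's setting plus a place datum (`B ≤ T'` containing `red(T^I)`,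
`D` normalising `I`, all conjugates of `I` inside `U_r`) and `hur` (`res_{U_r} c_{i,s}`, `s ⊆ r`, is a
coboundary on every conjugate of `I`): there are refined data `(z, η)` with `[z] = D_r (red_* c_{i,r})`,
(C2) `η_{gδ} − δ⁻¹η_g ∈ B`, (L) `g⁻¹ z(gδg⁻¹) − (δη_g − η_g) ∈ B` (`δ ∈ D`) and `= 0` (`δ ∈ I`), and
`g · (z, η) − (z, η)` null (`g · z − z = dα`, `η_{g⁻¹h} − η_h ≡ h⁻¹ α (mod B)`) for every `g ∈ Γ_i`.
[cite: Rubin2000, Lemma 4.4.2 and Thm. 4.5.1] [cite: MazurRubin2004, App. A Prop. A.2 and Remark A.5] -/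
theorem exists_refined_deriv_fixed (hc : IsEulerSystem L T p c) (rd : T.toTopRep ⟶ T'.toTopRep)
    (i : ι) (r : L.Ideals)
    (σ : HeightOneSpectrum (𝓞 K) → absoluteGaloisGroup K) (N : HeightOneSpectrum (𝓞 K) → ℕ)
    (Fr : HeightOneSpectrum (𝓞 K) → absoluteGaloisGroup K)
    (hσp : ∀ ℓ ∈ r.1, σ ℓ ∈ L.pLevel i)
    (hσ : ∀ ℓ ∈ r.1, ∀ q ∈ r.1, q ≠ ℓ → σ ℓ ∈ L.tameLevel q)
    (hcov : ∀ ℓ ∈ r.1, ∀ g : absoluteGaloisGroup K, ∃ j < N ℓ, (σ ℓ ^ j)⁻¹ * g ∈ L.tameLevel ℓ)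
    (hinj : ∀ ℓ ∈ r.1, ∀ j₁ < N ℓ, ∀ j₂ < N ℓ, (σ ℓ ^ j₁)⁻¹ * σ ℓ ^ j₂ ∈ L.tameLevel ℓ → j₁ = j₂)
    (hFrp : ∀ ℓ ∈ r.1, Fr ℓ ∈ L.pLevel i) (hFr : ∀ ℓ ∈ r.1, IsArithFrobAtPlace K ℓ (Fr ℓ))
    (hram : ∀ ℓ ∈ r.1, ∀ s ⊆ r.1, ℓ ∉ s → ¬ SubgroupIsUnramifiedAt K (L.level i (insert ℓ s)) ℓ)
    (hM₁ : ∀ ℓ ∈ r.1, ∀ v : M', (N ℓ : A) • v = 0)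
    (hM₂ : ∀ ℓ ∈ r.1, ∀ v : M',
      (rubinEulerFactor T.toRepresentation (cyclotomicCharacterToUnits K p A) (Fr ℓ)).eval 1 • v = 0)
    (comm)
    (B : Submodule A T'.toTopRep) (D I : Subgroup (absoluteGaloisGroup K))
    (hIU : ∀ (g τ : absoluteGaloisGroup K), τ ∈ I → g * τ * g⁻¹ ∈ L.level i r.1)
    (hID : ∀ δ ∈ D, ∀ τ ∈ I, δ⁻¹ * τ * δ ∈ I)
    (hB : ∀ t : T.toTopRep, (∀ τ ∈ I, T.toTopRep.ρ τ t = t) → rd.hom t ∈ B)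
    (hur : ∀ (s : Finset (HeightOneSpectrum (𝓞 K))) (hs : s ⊆ r.1)
      (φ : contOneCocycles (subgroupRep T.toTopRep (L.level i r.1))),
      oneCocycleClass _ φ =
        resLe T.toTopRep (level_antitone L i hs) 1 (c i ⟨s, fun q hq => r.2 q (hs hq)⟩) →
      ∀ g : absoluteGaloisGroup K, ∃ S : T.toTopRep, ∀ (τ : absoluteGaloisGroup K) (hτ : τ ∈ I),
        φ.1 ⟨g * τ * g⁻¹, hIU g τ hτ⟩ = T.toTopRep.ρ (g * τ * g⁻¹) S - S) :
    ∃ (z : contOneCocycles (subgroupRep T'.toTopRep (L.level i r.1)))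
      (η : absoluteGaloisGroup K → T'.toTopRep),
      oneCocycleClass _ z =
        (r.1.noncommProd (fun ℓ => ∑ j ∈ range (N ℓ), (j : Module.End A (continuousCohomology 1
          (subgroupRep T'.toTopRep (L.level i r.1)))) *
          (conjMap T'.toTopRep (L.level i r.1) (σ ℓ) 1).hom.toLinearMap ^ j) comm)
        (ContinuousCohomology.map (ContinuousMonoidHom.id _) (X := subgroupRep T.toTopRep (L.level i r.1))
          (Y := subgroupRep T'.toTopRep (L.level i r.1)) ((TopRep.resFunctor (L.level i r.1).subtype).map rd)
          1 (c i r)) ∧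
      (∀ (g δ : absoluteGaloisGroup K), δ ∈ D → η (g * δ) - T'.toTopRep.ρ δ⁻¹ (η g) ∈ B) ∧
      (∀ (g δ : absoluteGaloisGroup K), δ ∈ D → ∀ (h : g * δ * g⁻¹ ∈ L.level i r.1),
        T'.toTopRep.ρ g⁻¹ (z.1 ⟨g * δ * g⁻¹, h⟩) - (T'.toTopRep.ρ δ (η g) - η g) ∈ B) ∧
      (∀ (g τ : absoluteGaloisGroup K) (hτ : τ ∈ I),
        T'.toTopRep.ρ g⁻¹ (z.1 ⟨g * τ * g⁻¹, hIU g τ hτ⟩) - (T'.toTopRep.ρ τ (η g) - η g) = 0) ∧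
      (∀ g ∈ L.pLevel i, ∃ α : T'.toTopRep,
        (∀ x : L.level i r.1, (𝔠⟦T'.toTopRep, L.level i r.1, g⟧ z - z).1 x =
          T'.toTopRep.ρ (x : absoluteGaloisGroup K) α - α) ∧
        ∀ h : absoluteGaloisGroup K, (η (g⁻¹ * h) - η h) - T'.toTopRep.ρ h⁻¹ α ∈ B) := by
  classical
  set U : Subgroup (absoluteGaloisGroup K) := L.level i r.1 with hUdef
  -- §0 the refined module `S ⧸ N` and its `Γ`-action
  obtain ⟨S, hS⟩ := exists_submodule_refined₁ T'.toTopRep U B D I hIU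
  obtain ⟨Nn, hN⟩ := exists_submodule_null₁ T'.toTopRep U B
  obtain ⟨act, hact, hact_mul, hact_one⟩ := exists_act₁ T'.toTopRep U
  have hactS : ∀ g, ∀ q ∈ S, act g q ∈ S := fun g q hq =>
    act_mem_refined₁ T'.toTopRep U B D I hIU act hact S hS g q hq
  have hactN : ∀ g, ∀ q ∈ Nn, act g q ∈ Nn := fun g q hq =>
    act_mem_null₁ T'.toTopRep U B act hact Nn hN g q hq
  set NS : Submodule A S := Nn.comap S.subtype with hNSdef
  obtain ⟨actS, hactS_val⟩ : ∃ actS : absoluteGaloisGroup K → (S →ₗ[A] S), ∀ g (q : S),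
      ((actS g q : S) : C(U, subgroupRep T'.toTopRep U) × (absoluteGaloisGroup K → T'.toTopRep)) = act g q :=
    ⟨fun g => (act g).restrict (hactS g), fun g q => rfl⟩
  have hNS : ∀ g, NS ≤ NS.comap (actS g) := fun g q hq => by
    change ((actS g q : S) : C(U, subgroupRep T'.toTopRep U) × (absoluteGaloisGroup K → T'.toTopRep)) ∈ Nn
    rw [hactS_val]
    exact hactN g _ hq
  obtain ⟨E, hE⟩ : ∃ E : absoluteGaloisGroup K → Module.End A (S ⧸ NS), ∀ g (q : S),
      E g (NS.mkQ q) = NS.mkQ (actS g q) :=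
    ⟨fun g => NS.mapQ NS (actS g) (hNS g), fun g q => rfl⟩
  have hmk0 : ∀ q : S, NS.mkQ q = 0 ↔
      (q : C(U, subgroupRep T'.toTopRep U) × (absoluteGaloisGroup K → T'.toTopRep)) ∈ Nn := fun q => by
    rw [Submodule.mkQ_apply, Submodule.Quotient.mk_eq_zero, hNSdef, Submodule.mem_comap]
    rfl
  have hmksub : ∀ q q' : S, NS.mkQ q = NS.mkQ q' ↔
      ((q : C(U, subgroupRep T'.toTopRep U) × (absoluteGaloisGroup K → T'.toTopRep)) - q') ∈ Nn :=
    fun q q' => by rw [← sub_eq_zero, ← map_sub, hmk0, Submodule.coe_sub]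
  have hEmul : ∀ g h, E (g * h) = E g * E h := by
    intro g h
    refine LinearMap.ext fun y => ?_
    obtain ⟨q, rfl⟩ := Submodule.mkQ_surjective NS y
    rw [Module.End.mul_apply, hE, hE, hE]
    exact congrArg _ (Subtype.ext (by rw [hactS_val, hactS_val, hactS_val, hact_mul]))
  have hE1 : E 1 = 1 := by
    refine LinearMap.ext fun y => ?_
    obtain ⟨q, rfl⟩ := Submodule.mkQ_surjective NS y
    rw [hE, Module.End.one_apply]
    exact congrArg _ (Subtype.ext (by rw [hactS_val, hact_one]))
  have hEpow : ∀ g (j : ℕ), E g ^ j = E (g ^ j) := by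
    intro g j
    induction j with
    | zero => rw [pow_zero, pow_zero, hE1]
    | succ j ih => rw [pow_succ, pow_succ, ih, hEmul]
  -- `U` acts trivially (file A, (C1))
  have hEU : ∀ u ∈ U, E u = 1 := by
    intro u hu
    refine LinearMap.ext fun y => ?_
    obtain ⟨q, rfl⟩ := Submodule.mkQ_surjective NS y
    rw [hE, Module.End.one_apply, hmksub, hactS_val]
    have hq := (hS q).mp q.2
    exact act_sub_mem_null₁ T'.toTopRep U B act hact Nn hN u hu q.1 hq.1 hq.2.1
  -- the operators commute (commutators lie in `U`)
  have hEcomm : ∀ a b, Commute (E a) (E b) := by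
    intro a b
    have hmem : a⁻¹ * b⁻¹ * a * b ∈ U := by
      refine L.commutator_le_level i r.1 ?_
      have e : a⁻¹ * b⁻¹ * a * b = ⁅a⁻¹, b⁻¹⁆ := by
        rw [commutatorElement_def, inv_inv, inv_inv]
      rw [e, commutator_def]
      exact Subgroup.commutator_mem_commutator (Subgroup.mem_top _) (Subgroup.mem_top _)
    have e1 : E (a⁻¹ * b⁻¹ * a * b) = 1 := hEU _ hmem
    calc E a * E b = E (a * b) := (hEmul a b).symm
      _ = E (b * a * (a⁻¹ * b⁻¹ * a * b)) := congrArg E (mul_eq_mul_mul_comm₁ a b)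
      _ = E (b * a) * E (a⁻¹ * b⁻¹ * a * b) := hEmul _ _
      _ = E (b * a) := (congrArg (E (b * a) * ·) e1).trans (mul_one _)
      _ = E b * E a := hEmul b a
  -- generators: every `g ∈ Γ_i` is `w · u`, `w` a word in the `σ_ℓ`, `u ∈ U` (file C3)
  have hgen := exists_mem_closure_inv_mul_mem_level (L := L) i r σ N hσp hσ hcov
  let Eσ : HeightOneSpectrum (𝓞 K) → Module.End A (S ⧸ NS) := fun ℓ => E (σ ℓ)
  let F : HeightOneSpectrum (𝓞 K) → Module.End A (S ⧸ NS) := fun ℓ => E (Fr ℓ)⁻¹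
  let P : HeightOneSpectrum (𝓞 K) → A[X] := fun ℓ =>
    rubinEulerFactor T.toRepresentation (cyclotomicCharacterToUnits K p A) (Fr ℓ)
  have hEE : ∀ a b, Commute (Eσ a) (Eσ b) := fun a b => hEcomm _ _
  have hFE : ∀ a b, Commute (F a) (Eσ b) := fun a b => hEcomm _ _
  -- §1 the Euler family in the refined module
  have hUle : ∀ {s : Finset (HeightOneSpectrum (𝓞 K))}, s ⊆ r.1 → U ≤ L.level i s :=
    fun hs => level_antitone L i hs
  have hrep : ∀ (s : Finset (HeightOneSpectrum (𝓞 K))) (hs : s ⊆ r.1),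
      ∃ (φ : contOneCocycles (subgroupRep T.toTopRep U)) (sd : absoluteGaloisGroup K → T.toTopRep),
        oneCocycleClass _ φ = resLe T.toTopRep (hUle hs) 1 (c i ⟨s, fun q hq => r.2 q (hs hq)⟩) ∧
        ∀ (h τ : absoluteGaloisGroup K) (hτ : τ ∈ I),
          T.toTopRep.ρ h⁻¹ (φ.1 ⟨h * τ * h⁻¹, hIU h τ hτ⟩) = T.toTopRep.ρ τ (sd h) - sd h := by
    intro s hs
    obtain ⟨φ, hφ⟩ := oneCocycleClass_surjective _
      (resLe T.toTopRep (hUle hs) 1 (c i ⟨s, fun q hq => r.2 q (hs hq)⟩))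
    obtain ⟨sd, hsd⟩ := exists_data_of_unramified T.toTopRep U I hIU φ (hur s hs φ hφ)
    exact ⟨φ, sd, hφ, hsd⟩
  choose φ sd hφ hsd using hrep
  -- refined reductions are in `S`
  have hmemS : ∀ (ψ : contOneCocycles (subgroupRep T.toTopRep U)) (sd' : absoluteGaloisGroup K → T.toTopRep),
      (∀ (h τ : absoluteGaloisGroup K) (hτ : τ ∈ I),
        T.toTopRep.ρ h⁻¹ (ψ.1 ⟨h * τ * h⁻¹, hIU h τ hτ⟩) = T.toTopRep.ρ τ (sd' h) - sd' h) →
      (((contOneCocycles.pullback (ContinuousMonoidHom.id _) (X := subgroupRep T.toTopRep U) (Y := subgroupRep T'.toTopRep U) ((TopRep.resFunctor U.subtype).map rd) ψ).1, fun g => rd.hom (sd' g)) : C(U, subgroupRep T'.toTopRep U) × (absoluteGaloisGroup K → T'.toTopRep)) ∈ S := by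
    intro ψ sd' hsd'
    rw [hS]
    exact ⟨(contOneCocycles.pullback (ContinuousMonoidHom.id _) (X := subgroupRep T.toTopRep U) (Y := subgroupRep T'.toTopRep U) ((TopRep.resFunctor U.subtype).map rd) ψ).2, C1_rhoHat T'.toTopRep T.toTopRep U B I rd hIU hB ψ sd' hsd',
      C2_rhoHat T'.toTopRep T.toTopRep U B D I rd hIU hID hB ψ sd' hsd',
      L_mem_rhoHat T'.toTopRep T.toTopRep U B D I rd hIU hID hB ψ sd' hsd',
      L_eq_rhoHat T'.toTopRep T.toTopRep U I rd hIU ψ sd' hsd'⟩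
  let qS : ∀ (s : Finset (HeightOneSpectrum (𝓞 K))), s ⊆ r.1 → S := fun s hs =>
    ⟨_, hmemS (φ s hs) (sd s hs) (hsd s hs)⟩
  let x : Finset (HeightOneSpectrum (𝓞 K)) → S ⧸ NS := fun s =>
    if hs : s ⊆ r.1 then NS.mkQ (qS s hs) else 0
  have hx : ∀ {s} (hs : s ⊆ r.1), x s = NS.mkQ (qS s hs) := fun hs => dif_pos hs
  -- KEY transfer: another representative/trivialisation of `g · [φ_s]` gives `E g (x s)`
  have hkey : ∀ (s : Finset (HeightOneSpectrum (𝓞 K))) (hs : s ⊆ r.1)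
      (ψ : contOneCocycles (subgroupRep T.toTopRep U)) (sd' : absoluteGaloisGroup K → T.toTopRep)
      (hsd' : ∀ (h τ : absoluteGaloisGroup K) (hτ : τ ∈ I),
        T.toTopRep.ρ h⁻¹ (ψ.1 ⟨h * τ * h⁻¹, hIU h τ hτ⟩) = T.toTopRep.ρ τ (sd' h) - sd' h)
      (g : absoluteGaloisGroup K),
      oneCocycleClass _ ψ = conjMap T.toTopRep U g 1 (oneCocycleClass _ (φ s hs)) →
      NS.mkQ ⟨_, hmemS ψ sd' hsd'⟩ = E g (x s) := by
    intro s hs ψ sd' hsd' g hψ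
    rw [hx hs, hE, hmksub, hN]
    obtain ⟨α, hα, hη⟩ := null_rhoHat_sub_conj_rhoHat T'.toTopRep T.toTopRep U B I rd hIU hB (φ s hs) ψ g hψ
      (sd s hs) sd' (hsd s hs) hsd'
    refine ⟨α, fun y => ?_, fun h => ?_⟩
    · rw [Prod.fst_sub, hactS_val, hact, ContinuousMap.sub_apply]
      have h1 := hα y
      rw [Submodule.coe_sub, ContinuousMap.sub_apply] at h1
      exact h1
    · rw [Prod.snd_sub, hactS_val, hact]
      exact hη h
  -- §2 the Euler-family hypotheses of F1: (hfix) `σ_ℓ ∈ U_s` (`ℓ ∉ s`) acts trivially on `res c_{i,s}`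
  have hσUs : ∀ {s} (hs : s ⊆ r.1), ∀ ℓ ∈ r.1, ℓ ∉ s → σ ℓ ∈ L.level i s :=
    fun hs ℓ hℓ hℓs => sigma_mem_level_of_not_mem (L := L) i r σ hσp hσ hs ℓ hℓ hℓs
  have hfix : ∀ s ⊆ r.1, ∀ ℓ ∈ r.1, ℓ ∉ s → Eσ ℓ (x s) = x s := by
    intro s hs ℓ hℓ hℓs
    have h := hkey s hs (φ s hs) (sd s hs) (hsd s hs) (σ ℓ) (by
      rw [hφ, ← resLe_conjMap, conjMap_eq_self_of_mem T.toTopRep (hσUs hs ℓ hℓ hℓs)])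
    rw [hx hs] at h ⊢
    exact h.symm
  -- (hord) `σ_ℓ^{N_ℓ} ∈ U` acts trivially
  have hσN : ∀ ℓ ∈ r.1, σ ℓ ^ N ℓ ∈ U := fun ℓ hℓ =>
    mem_level_of_forall L (Subgroup.pow_mem _ (hσp ℓ hℓ) _) fun q hq => by
      by_cases hqℓ : q = ℓ
      · subst hqℓ; exact pow_mem_tameLevel_of_cov_inj L (hcov q hq) (hinj q hq)
      · exact Subgroup.pow_mem _ (hσ ℓ hℓ q hq hqℓ) _
  have hord : ∀ s ⊆ r.1, ∀ ℓ ∈ s, (Eσ ℓ ^ N ℓ) (x s) = x s := by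
    intro s hs ℓ hℓ
    change (E (σ ℓ) ^ N ℓ) (x s) = x s
    rw [hEpow, hEU _ (hσN ℓ (hs hℓ)), Module.End.one_apply]
  -- torsion: `N_ℓ` and `P_ℓ(1)` kill the refined module
  have htors : ∀ a : A, (∀ v : M', a • v = 0) → ∀ y : S ⧸ NS, a • y = 0 := by
    intro a ha y
    obtain ⟨q, rfl⟩ := Submodule.mkQ_surjective NS y
    rw [← map_smul, show a • q = 0 from ?_, map_zero]
    apply Subtype.ext
    change a • (q : C(U, subgroupRep T'.toTopRep U) × (absoluteGaloisGroup K → T'.toTopRep)) = 0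
    ext x
    · exact ha _
    · exact ha _
  have hN' : ∀ ℓ ∈ r.1, ∀ y : S ⧸ NS, (N ℓ : A) • y = 0 := fun ℓ hℓ => htors _ (hM₁ ℓ hℓ)
  have hP' : ∀ ℓ ∈ r.1, ∀ y : S ⧸ NS, (P ℓ).eval 1 • y = 0 := fun ℓ hℓ => htors _ (hM₂ ℓ hℓ)
  -- (hF) `Fr_ℓ⁻¹` fixes the common fixed vectors of the `σ_q`
  have hF' : ∀ ℓ ∈ r.1, ∀ y : S ⧸ NS, (∀ q ∈ r.1, Eσ q y = y) → F ℓ y = y := by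
    intro ℓ hℓ y hy
    refine fixed_of_forall_gens E hEmul hE1 U hEU (σ '' (r.1 : Set (HeightOneSpectrum (𝓞 K))))
      (L.pLevel i : Set (absoluteGaloisGroup K)) hgen y ?_ (Fr ℓ)⁻¹
      (Subgroup.inv_mem _ (hFrp ℓ hℓ))
    rintro _ ⟨q, hq, rfl⟩
    exact hy q (Finset.mem_coe.mp hq)
  -- (hnorm) the norm relations, transported from `H¹(U, T)` (files C3, C2″, C1)
  have hnorm : ∀ s ⊆ r.1, ∀ ℓ ∈ s,
      (∑ j ∈ range (N ℓ), Eσ ℓ ^ j) (x s) = aeval (F ℓ) (P ℓ) (x (s.erase ℓ)) := by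
    intro s hs ℓ hℓ
    have hs' : s.erase ℓ ⊆ r.1 := (Finset.erase_subset ℓ s).trans hs
    -- the T-level identity in combination form (file C3)
    have hT := oneCocycleClass_normCombination_eq_of_subset hc i r σ N Fr hσp hσ hcov hinj hFr hram
      (U := U) le_rfl hs hℓ (φ s hs) (hφ s hs) (φ (s.erase ℓ) hs') (hφ (s.erase ℓ) hs')
    -- data of the two combinations
    have hsdL := data_combination T.toTopRep U I hIU (range (N ℓ)) (fun _ => (1 : A)) (fun j => σ ℓ ^ j)
      (φ s hs) (sd s hs) (hsd s hs)
    have hsdR := data_combination T.toTopRep U I hIU (range ((P ℓ).natDegree + 1))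
      (fun n => (P ℓ).coeff n) (fun n => (Fr ℓ)⁻¹ ^ n) (φ (s.erase ℓ) hs') (sd (s.erase ℓ) hs')
      (hsd (s.erase ℓ) hs')
    -- both sides as `mk` of the combinations
    have eL : (∑ j ∈ range (N ℓ), Eσ ℓ ^ j) (x s) = NS.mkQ ⟨_, hmemS _ _ hsdL⟩ := by
      rw [LinearMap.sum_apply, hx hs]
      have e1 : ∀ j ∈ range (N ℓ), (Eσ ℓ ^ j) (NS.mkQ (qS s hs)) =
          NS.mkQ ((1 : A) • actS (σ ℓ ^ j) (qS s hs)) := by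
        intro j _
        change (E (σ ℓ) ^ j) (NS.mkQ (qS s hs)) = _
        rw [hEpow, hE, one_smul]
      rw [Finset.sum_congr rfl e1, ← map_sum]
      congr 1
      apply Subtype.ext
      rw [Submodule.coe_sum]
      simp only [Submodule.coe_smul, hactS_val]
      exact act_combination₁ T'.toTopRep T.toTopRep U rd act hact (range (N ℓ)) (fun _ => (1 : A))
        (fun j => σ ℓ ^ j) (φ s hs) (sd s hs)
    have eR : aeval (F ℓ) (P ℓ) (x (s.erase ℓ)) = NS.mkQ ⟨_, hmemS _ _ hsdR⟩ := by
      rw [aeval_eq_sum_range, LinearMap.sum_apply, hx hs']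
      have e1 : ∀ n ∈ range ((P ℓ).natDegree + 1),
          ((P ℓ).coeff n • F ℓ ^ n) (NS.mkQ (qS (s.erase ℓ) hs')) =
            NS.mkQ ((P ℓ).coeff n • actS ((Fr ℓ)⁻¹ ^ n) (qS (s.erase ℓ) hs')) := by
        intro n _
        change ((P ℓ).coeff n • E (Fr ℓ)⁻¹ ^ n) (NS.mkQ (qS (s.erase ℓ) hs')) = _
        rw [LinearMap.smul_apply, hEpow, hE, map_smul]
      rw [Finset.sum_congr rfl e1, ← map_sum]
      congr 1
      apply Subtype.ext
      rw [Submodule.coe_sum]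
      simp only [Submodule.coe_smul, hactS_val]
      exact act_combination₁ T'.toTopRep T.toTopRep U rd act hact (range ((P ℓ).natDegree + 1))
        (fun n => (P ℓ).coeff n) (fun n => (Fr ℓ)⁻¹ ^ n) (φ (s.erase ℓ) hs') (sd (s.erase ℓ) hs')
    rw [eL, eR, hmksub, hN]
    obtain ⟨α, hα, hη⟩ := null_rhoHat_sub_rhoHat T'.toTopRep T.toTopRep U B I rd hIU hB _ _ hT _ _
      hsdR hsdL
    refine ⟨α, fun y => ?_, fun h => ?_⟩
    · rw [Prod.fst_sub, ContinuousMap.sub_apply]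
      have h1 := hα y
      rw [Submodule.coe_sub, ContinuousMap.sub_apply] at h1
      exact h1
    · rw [Prod.snd_sub]
      exact hη h
  -- §3 F1: `D_r x_r` is fixed by every `σ_q`, hence by `Γ_i`
  have main := apply_noncommProd_deriv_apply_eq_of_eulerFamily Eσ F N P r.1 x hEE hFE hfix hord hnorm
    hN' hP' hF' r.1 subset_rfl
  set y := (r.1.noncommProd (fun ℓ => ∑ j ∈ range (N ℓ), (j : Module.End A (S ⧸ NS)) * Eσ ℓ ^ j)
    fun a _ b _ _ => commute_deriv_deriv hEE N a b) (x r.1) with hydef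
  have hall : ∀ g ∈ (L.pLevel i : Set (absoluteGaloisGroup K)), E g y = y := by
    intro g hg
    refine fixed_of_forall_gens E hEmul hE1 U hEU (σ '' (r.1 : Set (HeightOneSpectrum (𝓞 K))))
      (L.pLevel i : Set (absoluteGaloisGroup K)) hgen y ?_ g hg
    rintro _ ⟨q, hq, rfl⟩
    exact main q (Finset.mem_coe.mp hq)
  -- §4 the class of `y` read in `H¹(U, T')`: `π (mk q) = [q.1]`
  obtain ⟨πS, hπS⟩ : ∃ πS : S →ₗ[A] continuousCohomology 1 (subgroupRep T'.toTopRep U),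
      ∀ q : S, πS q = oneCocycleClass _ ⟨q.1.1, ((hS q.1).mp q.2).1⟩ :=
    ⟨{ toFun := fun q => oneCocycleClass _ ⟨q.1.1, ((hS q.1).mp q.2).1⟩
       map_add' := fun q q' => by rw [← oneCocycleClass_add]; rfl
       map_smul' := fun a q => by rw [RingHom.id_apply, ← oneCocycleClass_smul]; rfl }, fun q => rfl⟩
  have hπN : NS ≤ LinearMap.ker πS := by
    intro q hq
    rw [LinearMap.mem_ker, hπS, oneCocycleClass_eq_zero_iff]
    obtain ⟨α, hα, -⟩ := (hN _).mp hq
    exact ⟨α, fun x => hα x⟩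
  obtain ⟨π, hπ⟩ : ∃ π : S ⧸ NS →ₗ[A] continuousCohomology 1 (subgroupRep T'.toTopRep U),
      ∀ q : S, π (NS.mkQ q) = πS q := ⟨NS.liftQ πS hπN, fun q => rfl⟩
  have hπE : ∀ g (v : S ⧸ NS), π (E g v) = conjMap T'.toTopRep U g 1 (π v) := by
    intro g v
    obtain ⟨q, rfl⟩ := Submodule.mkQ_surjective NS v
    rw [hE, hπ, hπ, hπS, hπS, conjMap_oneCocycleClass]
    congr 1
    apply Subtype.ext
    change ((actS g q : S) : C(U, subgroupRep T'.toTopRep U) × (absoluteGaloisGroup K → T'.toTopRep)).1 = _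
    rw [hactS_val, hact]
    rfl
  have hπD : π y = (r.1.noncommProd (fun ℓ => ∑ j ∈ range (N ℓ), (j : Module.End A
        (continuousCohomology 1 (subgroupRep T'.toTopRep U))) *
        (conjMap T'.toTopRep U (σ ℓ) 1).hom.toLinearMap ^ j) comm) (π (x r.1)) := by
    rw [hydef]
    refine apply_noncommProd_apply_eq_of_comm π r.1 _ _ (fun ℓ _ v => ?_) (x r.1)
    exact apply_deriv_apply_eq_of_comm π (F := Eσ ℓ)
      (F' := (conjMap T'.toTopRep U (σ ℓ) 1).hom.toLinearMap) (fun v => hπE (σ ℓ) v) (N ℓ) v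
  have hπx : π (x r.1) = ContinuousCohomology.map (ContinuousMonoidHom.id _)
      (X := subgroupRep T.toTopRep U) (Y := subgroupRep T'.toTopRep U)
      ((TopRep.resFunctor U.subtype).map rd) 1 (c i r) := by
    rw [hx subset_rfl, hπ, hπS]
    change oneCocycleClass _ (contOneCocycles.pullback (ContinuousMonoidHom.id _) (X := subgroupRep T.toTopRep U) (Y := subgroupRep T'.toTopRep U) ((TopRep.resFunctor U.subtype).map rd) (φ r.1 subset_rfl)) = _
    rw [← red_oneCocycleClass rd U (φ r.1 subset_rfl), hφ]
    exact congrArg _ (resLe_refl_apply T.toTopRep (c i r))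
  -- §5 unpack a representative of `y`
  obtain ⟨qf, hqf⟩ := Submodule.mkQ_surjective NS y
  have hqS := (hS qf.1).mp qf.2
  refine ⟨⟨qf.1.1, hqS.1⟩, qf.1.2, ?_, hqS.2.2.1, hqS.2.2.2.1, hqS.2.2.2.2, fun g hg => ?_⟩
  · rw [← hπS, ← hπ, hqf, hπD, hπx]
  · have h1 := hall g hg
    rw [← hqf, hE, hmksub, hN] at h1
    obtain ⟨α, hα, hη⟩ := h1
    refine ⟨α, fun x' => ?_, fun h => ?_⟩
    · have h2 := hα x'
      rw [Prod.fst_sub, hactS_val, hact, ContinuousMap.sub_apply] at h2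
      rw [Submodule.coe_sub, ContinuousMap.sub_apply]
      exact h2
    · have h2 := hη h
      rw [Prod.snd_sub, hactS_val, hact] at h2
      exact h2

end Summit.BirchSwinnertonDyer.BirchSwinnertonDyer.Theorems.KimAtThreeD7uRefined

end
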